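/- Width seat `ym-line-cbag-p1-w3` (prover-ym-line-cbag-p1-w3-g0-0), route `ColdBoxAllGroups`, crux `BoxFloorAllGroups`
(stmt-QuantumFields-22254), line `birth`: glue-1 «LargeFieldG» toward the lead's stub S3c-G `stub_boxGaussianDominationG`. -/
import Summits.QuantumFields.YangMills.Theorems.WeakCouplingRatesColdBoxLargeFieldSU2

/-!
# Crux `BoxFloorAllGroups`, glue-1: large fields are rare in the cold-wall box of EVERY compact group presented in `U(N)`
# (`boxState ρ β ⌈β^θ⌉ {∃ p : cost_p ≥ β^{2ε−1}} ≤ exp(−β^ε)`, `ε > 2θ`)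

The `G`-generic port of the `SU(2)` piece S3c-i (`WeakCouplingRatesColdBoxLargeFieldSU2.boxState_largeField_rarity`) of the
proved crux `ColdBoxTwoPointFloorW`, for the all-groups crux `BoxFloorAllGroups` of route `ColdBoxAllGroups` (its load-bearing
stub S3c-G `stub_boxGaussianDominationG` re-runs the `SU(2)` one-scale Laplace expansion for every compact simple `G`; this file is
its first, group-uniform, input).  For a compact group `G` with a continuous UNITARY representation `ρ : G →* U(N)` (faithfulness is
not needed here):

* `exists_boxState_real_le_of_rep` — the Gibbs–Laplace bound of the generic file `WeakCouplingRatesColdBoxLargeField`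
  (`ymSpecification_one_real_le`) specialised to the cold-wall box state `boxState ρ β H` with radius `r = β^{−1/2}`:
  `boxState(E) ≤ e^{−βs₀} · e^{8N·#Λ'} · (c⁻¹(√β)^D)^{#Λ}` whenever `S_Λ ≥ s₀` on `E` (`Λ = boxEdges 4 (2H+1)`, `Λ'` the plaquettes
  touching it), where `D = dim 𝔤(ρ(G))` and `c` is the small-ball constant of the compact linear group `ρ(G)` — the tree's
  `HaarSmallBallClosedSubgroup.haarReal_ball_ge_of_unitaryRep` (`Haar{‖ρ g − 1‖ ≤ r} ≥ c·r^D`, Varopoulos–Saloff-Coste–Coulhon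
  Thm. V.4.1), replacing the `SU(2)` constant with exponent `3`;
* `measurableSet_exists_plaqCost_ge_of_rep`, `le_wilsonBoundaryAction_of_exists_plaqCost_ge_of_rep`,
  `exists_boxState_largeField_le_of_rep` — the same for the large-field event «some plaquette touching `Λ` costs
  `N − Re tr ρ(U_p) ≥ s`»;
* `boxState_largeField_rarity_of_rep` — **S3c-i for all `G`**: for `0 < θ`, `2θ < ε`, eventually in `β`,
  `boxState ρ β ⌈β^θ⌉ {∃ p touching the box : cost_p ≥ β^{2ε−1}} ≤ exp(−β^ε)` (only `D` and `N` enter the constants, through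
  `(D/2)·#Λ·log β + 8N·#Λ'` against the gain `β^{2ε}`; the exponent window `ε > 2θ` is that of the `SU(2)` proof).

Everything is proved; no definition, no named fact; standard axioms.  NOT a statement about the Yang–Mills mass gap (rung-level
support, RECORD label).
-/

set_option autoImplicit false

noncomputable section

open MeasureTheory Finset
open scoped Matrix.Norms.L2Operator
open Literature.MathematicalPhysics.QuantumLattice
open Literature.MathematicalPhysics.QuantumFieldTheory

namespace Summit.QuantumFields.YangMills.Theorems.WeakCouplingRates

section RepBox

open Literature.MathematicalPhysics.QuantumFieldTheory.Balaban1983to89.HaarSmallBallClosedSubgroup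
  (haarReal_ball_ge_of_unitaryRep)

variable {N : ℕ} {G : Type*} [Group G] [TopologicalSpace G] [IsTopologicalGroup G] [CompactSpace G]
  [MeasurableSpace G] [BorelSpace G] [SecondCountableTopology G]
variable (ρ : G →* Matrix (Fin N) (Fin N) ℂ)

/-- **The Gibbs large-field bound in the cold-wall box of a compact group presented in `U(N)`, radius `r = β^{-1/2}`.**
For a continuous unitary representation `ρ` there is `c > 0` (the inverse of the small-ball constant of `ρ(G)`) such that, with
`D = dim_ℝ 𝔤(ρ(G))`, for every half-side `H`, every `β ≥ 1`, every measurable event `E` on which the boundary Wilson action of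
`Λ = boxEdges 4 (2H+1)` is at least `s₀`: `boxState(E) ≤ e^{−βs₀} · e^{8N·#Λ'} · (c·(√β)^D)^{#Λ}`. -/
theorem exists_boxState_real_le_of_rep [NeZero N] (hρc : Continuous ρ) (hρu : ∀ g, ρ g ∈ Matrix.unitaryGroup (Fin N) ℂ) :
    ∃ c : ℝ, 0 < c ∧ ∀ (H : ℕ) (β : ℝ), 1 ≤ β →
      ∀ (E : Set (LGConfig 4 G)), MeasurableSet E → ∀ (s₀ : ℝ),
        (∀ U ∈ E, s₀ ≤ wilsonBoundaryAction ρ (AxialGauge.boxEdges 4 (2 * H + 1)) U) →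
        (boxState ρ β H).real E ≤
          Real.exp (-(β * s₀)) * Real.exp (8 * N * #(plaquettesTouching (AxialGauge.boxEdges 4 (2 * H + 1)))) *
            (c * Real.sqrt β ^ Module.finrank ℝ (matrixLieAlgebra (Set.range ρ))) ^
              #(AxialGauge.boxEdges 4 (2 * H + 1)) := by
  obtain ⟨c, hc, -, hball⟩ := haarReal_ball_ge_of_unitaryRep ρ hρc hρu (R := 1) one_pos
  refine ⟨c⁻¹, by positivity, ?_⟩
  intro H β hβ E hE s₀ hs
  set D : ℕ := Module.finrank ℝ (matrixLieAlgebra (Set.range ρ)) with hD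
  set Λ := AxialGauge.boxEdges 4 (2 * H + 1) with hΛ
  have hβ0 : 0 < β := one_pos.trans_le hβ
  -- radius and small-ball constant
  set q : ℝ := Real.sqrt β with hq
  have hq1 : 1 ≤ q := by rw [hq]; exact Real.one_le_sqrt.2 hβ
  have hq0 : 0 < q := one_pos.trans_le hq1
  set r : ℝ := q⁻¹ with hr
  have hr0 : 0 < r := inv_pos.2 hq0
  have hr1 : r ≤ 1 := inv_le_one_of_one_le₀ hq1
  have hr2 : β * r ^ 2 = 1 := by
    rw [hr, inv_pow, hq, Real.sq_sqrt hβ0.le, mul_inv_cancel₀ hβ0.ne']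
  haveI : (haarProbability G).IsMulLeftInvariant := by
    unfold haarProbability; infer_instance
  have hb : c * r ^ D ≤ (haarProbability G).real {g | ‖ρ g - 1‖ ≤ r} := hball (haarProbability G) r hr0 hr1
  have hcb : 0 < c * r ^ D := by positivity
  have key := ymSpecification_one_real_le ρ hρu hρc hβ0.le Λ hE hs hr0.le hcb hb
  have hbox : boxState ρ β H = ymSpecification ρ β Λ (fun _ => 1) := rfl
  rw [hbox]
  refine key.trans (le_of_eq ?_)
  -- bookkeeping
  have e1 : β * (#(plaquettesTouching Λ) * (8 * (N : ℝ) * r ^ 2)) = 8 * N * #(plaquettesTouching Λ) := by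
    have : β * (#(plaquettesTouching Λ) * (8 * (N : ℝ) * r ^ 2)) = 8 * N * #(plaquettesTouching Λ) * (β * r ^ 2) := by
      ring
    rw [this, hr2, mul_one]
  have e2 : (c * r ^ D)⁻¹ = c⁻¹ * q ^ D := by
    rw [hr, inv_pow, mul_inv, inv_inv]
  rw [e1, div_eq_mul_inv, ← inv_pow, e2]

omit [CompactSpace G] in
/-- The large-field event «some plaquette touching `Λ` costs at least `s`» is measurable (any continuous `ρ`). -/
theorem measurableSet_exists_plaqCost_ge_of_rep (hρc : Continuous ρ) (Λ : Finset (Literature.MathematicalPhysics.QuantumLattice.ZdEdge 4)) (s : ℝ) :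
    MeasurableSet {U : LGConfig 4 G |
      ∃ p ∈ plaquettesTouching Λ, s ≤ (N : ℝ) - plaquetteObs ρ p.1 p.2.1.1 p.2.1.2 U} := by
  have hset : {U : LGConfig 4 G | ∃ p ∈ plaquettesTouching Λ, s ≤ (N : ℝ) - plaquetteObs ρ p.1 p.2.1.1 p.2.1.2 U} =
      ⋃ p ∈ plaquettesTouching Λ, {U | s ≤ (N : ℝ) - plaquetteObs ρ p.1 p.2.1.1 p.2.1.2 U} := by
    ext U; simp
  rw [hset]
  refine Finset.measurableSet_biUnion _ fun p _ => measurableSet_le measurable_const ?_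
  have hc : Continuous fun U : LGConfig 4 G => (N : ℝ) - plaquetteObs ρ p.1 p.2.1.1 p.2.1.2 U := by
    unfold plaquetteObs plaquetteHolonomyZd
    fun_prop
  exact hc.measurable

omit [TopologicalSpace G] [IsTopologicalGroup G] [CompactSpace G] [MeasurableSpace G] [BorelSpace G]
  [SecondCountableTopology G] in
/-- On the large-field event the boundary Wilson action is at least `s` (unitary `ρ`: every plaquette term is `≥ 0`). -/
theorem le_wilsonBoundaryAction_of_exists_plaqCost_ge_of_rep [NeZero N] (hρu : ∀ g, ρ g ∈ Matrix.unitaryGroup (Fin N) ℂ)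
    {Λ : Finset (Literature.MathematicalPhysics.QuantumLattice.ZdEdge 4)} {s : ℝ} {U : LGConfig 4 G}
    (hU : ∃ p ∈ plaquettesTouching Λ, s ≤ (N : ℝ) - plaquetteObs ρ p.1 p.2.1.1 p.2.1.2 U) :
    s ≤ wilsonBoundaryAction ρ Λ U := by
  obtain ⟨p, hp, hsp⟩ := hU
  have h := plaqTerm_le_wilsonBoundaryAction ρ hρu hp U
  linarith

/-- **Large fields in the cold-wall box of a compact group presented in `U(N)` (explicit form).**  With the constant `c` of
`exists_boxState_real_le_of_rep` and `D = dim_ℝ 𝔤(ρ(G))`: for `β ≥ 1`, every `s` and every half-side `H`,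
`boxState{∃ p touching Λ : cost_p ≥ s} ≤ e^{−βs} · e^{8N·#Λ'} · (c(√β)^D)^{#Λ}`, `Λ = boxEdges 4 (2H+1)`. -/
theorem exists_boxState_largeField_le_of_rep [NeZero N] (hρc : Continuous ρ)
    (hρu : ∀ g, ρ g ∈ Matrix.unitaryGroup (Fin N) ℂ) :
    ∃ c : ℝ, 0 < c ∧ ∀ (H : ℕ) (β : ℝ), 1 ≤ β → ∀ (s : ℝ),
      (boxState ρ β H).real
          {U | ∃ p ∈ plaquettesTouching (AxialGauge.boxEdges 4 (2 * H + 1)),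
            s ≤ (N : ℝ) - plaquetteObs ρ p.1 p.2.1.1 p.2.1.2 U} ≤
        Real.exp (-(β * s)) * Real.exp (8 * N * #(plaquettesTouching (AxialGauge.boxEdges 4 (2 * H + 1)))) *
          (c * Real.sqrt β ^ Module.finrank ℝ (matrixLieAlgebra (Set.range ρ))) ^
            #(AxialGauge.boxEdges 4 (2 * H + 1)) := by
  obtain ⟨c, hc, h⟩ := exists_boxState_real_le_of_rep ρ hρc hρu
  refine ⟨c, hc, fun H β hβ s => ?_⟩
  have hE : MeasurableSet {U : LGConfig 4 G | ∃ p ∈ plaquettesTouching (AxialGauge.boxEdges 4 (2 * H + 1)),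
      s ≤ (N : ℝ) - plaquetteObs ρ p.1 p.2.1.1 p.2.1.2 U} :=
    measurableSet_exists_plaqCost_ge_of_rep ρ hρc _ s
  have hs : ∀ U ∈ {U : LGConfig 4 G | ∃ p ∈ plaquettesTouching (AxialGauge.boxEdges 4 (2 * H + 1)),
      s ≤ (N : ℝ) - plaquetteObs ρ p.1 p.2.1.1 p.2.1.2 U},
      s ≤ wilsonBoundaryAction ρ (AxialGauge.boxEdges 4 (2 * H + 1)) U :=
    fun U hU => le_wilsonBoundaryAction_of_exists_plaqCost_ge_of_rep ρ hρu hU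
  exact h H β hβ _ hE s hs

/-- **S3c-i for every compact group presented in `U(N)` (large fields are rare in the cold box, one-scale form).**  For a
continuous unitary `ρ : G →* U(N)`, `0 < θ` and `ε > 2θ`: for all large `β`, in the cold-wall box of half-side `⌈β^θ⌉` the
probability that SOME plaquette touching the box costs `N − Re tr ρ(U_p) ≥ β^{2ε−1}` is at most `exp(−β^ε)`.  The price of the
union-free, volume-dependent Gibbs bound is `#Λ·((D/2)·log β + |log c|) + 8N·#Λ'` with `#Λ, #Λ' ≍ β^{4θ}`, against the gain
`β·β^{2ε−1}`; hence the window `ε > 2θ`, exactly as for `SU(2)` (only constants see `D = dim 𝔤(ρ(G))` and `N`). -/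
theorem boxState_largeField_rarity_of_rep (hρc : Continuous ρ) (hρu : ∀ g, ρ g ∈ Matrix.unitaryGroup (Fin N) ℂ)
    {θ ε : ℝ} (hθ : 0 < θ) (hε : 2 * θ < ε) :
    ∃ β₀ : ℝ, ∀ β : ℝ, β₀ ≤ β →
      (boxState ρ β ⌈β ^ θ⌉₊).real
          {U | ∃ p ∈ plaquettesTouching (AxialGauge.boxEdges 4 (2 * ⌈β ^ θ⌉₊ + 1)),
            β ^ (2 * ε - 1) ≤ (N : ℝ) - plaquetteObs ρ p.1 p.2.1.1 p.2.1.2 U} ≤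
        Real.exp (-(β ^ ε)) := by
  rcases Nat.eq_zero_or_pos N with hN | hN
  · -- `N = 0`: every cost vanishes and the event is empty for `β > 0`
    subst hN
    refine ⟨1, fun β hβ => ?_⟩
    have hβ0 : 0 < β := one_pos.trans_le hβ
    have hempty : {U : LGConfig 4 G | ∃ p ∈ plaquettesTouching (AxialGauge.boxEdges 4 (2 * ⌈β ^ θ⌉₊ + 1)),
        β ^ (2 * ε - 1) ≤ ((0 : ℕ) : ℝ) - plaquetteObs ρ p.1 p.2.1.1 p.2.1.2 U} = ∅ := by
      ext U
      simp only [Set.mem_setOf_eq, Set.mem_empty_iff_false, iff_false, not_exists, not_and, not_le]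
      intro p _
      have h0 : plaquetteObs ρ p.1 p.2.1.1 p.2.1.2 U = 0 := by
        unfold plaquetteObs
        rw [Matrix.trace_eq_zero_of_isEmpty, Complex.zero_re]
      rw [h0, Nat.cast_zero, sub_zero]
      exact Real.rpow_pos_of_pos hβ0 _
    rw [hempty, measureReal_empty]
    exact (Real.exp_pos _).le
  haveI : NeZero N := ⟨hN.ne'⟩
  obtain ⟨c, hc, hmain⟩ := exists_boxState_largeField_le_of_rep ρ hρc hρu
  set D : ℕ := Module.finrank ℝ (matrixLieAlgebra (Set.range ρ)) with hD
  -- constants: #Λ' ≤ 120 n⁴ ≤ 75000 β^{4θ}, #Λ ≤ 4 n⁴ ≤ 2500 β^{4θ}, log(c (√β)^D) ≤ |log c| + (D/2) log β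
  obtain ⟨β₀, hβ₀1, hasy⟩ := eventually_neg_rpow_add_le hθ hε (8 * N * 75000 + 2500 * |Real.log c|) (2500 * (D / 2))
    (by positivity) (by positivity)
  refine ⟨β₀, fun β hβ => ?_⟩
  have hβ1 : 1 ≤ β := hβ₀1.trans hβ
  have hβ0 : 0 < β := one_pos.trans_le hβ1
  refine (hmain ⌈β ^ θ⌉₊ β hβ1 (β ^ (2 * ε - 1))).trans ?_
  set n : ℕ := 2 * ⌈β ^ θ⌉₊ + 1 with hn
  set Λ := AxialGauge.boxEdges 4 n with hΛ
  -- the box side in terms of β^θ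
  have hX1 : 1 ≤ β ^ θ := Real.one_le_rpow hβ1 hθ.le
  have hnR : (n : ℝ) ≤ 5 * β ^ θ := by
    have hc' : (⌈β ^ θ⌉₊ : ℝ) < β ^ θ + 1 := Nat.ceil_lt_add_one (by linarith)
    rw [hn]; push_cast; nlinarith
  have hn4 : (n : ℝ) ^ 4 ≤ 625 * β ^ (4 * θ) := by
    have e4 : β ^ (4 * θ) = (β ^ θ) ^ 4 := by
      rw [← Real.rpow_natCast (β ^ θ) 4, ← Real.rpow_mul hβ0.le]; norm_num; ring_nf
    rw [e4]
    calc (n : ℝ) ^ 4 ≤ (5 * β ^ θ) ^ 4 := pow_le_pow_left₀ (by positivity) hnR 4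
      _ = 625 * (β ^ θ) ^ 4 := by ring
  have hΛR : (#Λ : ℝ) ≤ 2500 * β ^ (4 * θ) := by
    have h := card_boxEdges_four_le n
    calc (#Λ : ℝ) ≤ ((4 * n ^ 4 : ℕ) : ℝ) := by rw [hΛ]; exact_mod_cast h
      _ = 4 * (n : ℝ) ^ 4 := by push_cast; ring
      _ ≤ 4 * (625 * β ^ (4 * θ)) := by linarith
      _ = 2500 * β ^ (4 * θ) := by ring
  have hΛ'R : (#(plaquettesTouching Λ) : ℝ) ≤ 75000 * β ^ (4 * θ) := by
    have h := card_plaquettesTouching_boxEdges_le n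
    calc (#(plaquettesTouching Λ) : ℝ) ≤ ((120 * n ^ 4 : ℕ) : ℝ) := by rw [hΛ]; exact_mod_cast h
      _ = 120 * (n : ℝ) ^ 4 := by push_cast; ring
      _ ≤ 120 * (625 * β ^ (4 * θ)) := by linarith
      _ = 75000 * β ^ (4 * θ) := by ring
  -- the base c (√β)^D as an exponential
  set a : ℝ := c * Real.sqrt β ^ D with ha
  have ha0 : 0 < a := by positivity
  have hloga : Real.log a ≤ |Real.log c| + D / 2 * Real.log β := by
    rw [ha, Real.log_mul hc.ne' (by positivity), Real.log_pow, Real.log_sqrt hβ0.le]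
    have := le_abs_self (Real.log c)
    have : (D : ℝ) * (Real.log β / 2) = D / 2 * Real.log β := by ring
    linarith
  have hpow : a ^ #Λ = Real.exp (#Λ * Real.log a) := by
    rw [Real.exp_nat_mul, Real.exp_log ha0]
  have hs : β * β ^ (2 * ε - 1) = β ^ (2 * ε) := by
    rw [show β * β ^ (2 * ε - 1) = β ^ (1 : ℝ) * β ^ (2 * ε - 1) by rw [Real.rpow_one],
      ← Real.rpow_add hβ0]; congr 1; ring
  rw [hpow, ← Real.exp_add, ← Real.exp_add, hs]
  refine Real.exp_le_exp.2 ?_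
  have hlog0 : 0 ≤ Real.log β := Real.log_nonneg hβ1
  have hY0 : 0 ≤ β ^ (4 * θ) := Real.rpow_nonneg hβ0.le _
  have hN0 : (0 : ℝ) ≤ N := Nat.cast_nonneg _
  have h3 : (#Λ : ℝ) * Real.log a ≤ 2500 * β ^ (4 * θ) * (|Real.log c| + D / 2 * Real.log β) := by
    calc (#Λ : ℝ) * Real.log a ≤ #Λ * (|Real.log c| + D / 2 * Real.log β) :=
          mul_le_mul_of_nonneg_left hloga (Nat.cast_nonneg _)
      _ ≤ 2500 * β ^ (4 * θ) * (|Real.log c| + D / 2 * Real.log β) :=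
          mul_le_mul_of_nonneg_right hΛR (by positivity)
  have h4 := hasy β hβ
  have h5 : 8 * (N : ℝ) * #(plaquettesTouching Λ) ≤ 8 * N * (75000 * β ^ (4 * θ)) :=
    mul_le_mul_of_nonneg_left hΛ'R (by positivity)
  nlinarith [h3, h4, h5, abs_nonneg (Real.log c)]

end RepBox

end Summit.QuantumFields.YangMills.Theorems.WeakCouplingRates

/-! ## Stub S1 of the lead's skeleton v4 (`Cruxes/BoxFloorAllGroups/Lines/birth.lean`), by name and signature

(Appended 2026-08-27 by the same seat.)  The registered stub S1 `stub_boxLargeFieldRarityG` of crux `BoxFloorAllGroups`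
(stmt-QuantumFields-22254) quantifies over compact simple `G` with ITS BOREL σ-algebra (`letI := borel G`) and a faithful unitary
lattice representation `r : LatticeRep G`; it is `boxState_largeField_rarity_of_rep` at `ρ = r.ρ` (second countability of `G` from
the closed embedding `r.ρ`; simplicity and faithfulness are not used).  The lead replaces the skeleton's `sorry` by
`Summit.QuantumFields.YangMills.Theorems.ColdBoxAllGroups.stub_boxLargeFieldRarityG`. -/

namespace Summit.QuantumFields.YangMills.Theorems.ColdBoxAllGroups

open Summit.QuantumFields.YangMills.Theorems.WeakCouplingRates

/-- **Stub S1 of crux `BoxFloorAllGroups` (line `birth`, skeleton v4) — large fields are rare in the cold-wall box, every compact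
simple `G`.**  For `0 < θ`, `2θ < ε`: eventually in `β`, the `boxState r.ρ β ⌈β^θ⌉`-probability that some plaquette touching
`Λ = boxEdges 4 (2⌈β^θ⌉+1)` costs `N − Re tr r(U_p) ≥ β^{2ε−1}` is `≤ exp(−β^ε)` (verbatim the registered signature;
`boxState_largeField_rarity_of_rep` at `ρ = r.ρ`). -/
theorem stub_boxLargeFieldRarityG :
    ∀ (G : Type) [Group G] [TopologicalSpace G] [IsTopologicalGroup G] [CompactSpace G],
    IsCompactSimpleLieGroup G →
    letI : MeasurableSpace G := borel G
    haveI : BorelSpace G := ⟨rfl⟩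
    ∀ r : LatticeRep G, ∀ θ ε : ℝ, 0 < θ → 2 * θ < ε → ∃ β₀ : ℝ, ∀ β : ℝ, β₀ ≤ β →
      (boxState r.ρ β ⌈β ^ θ⌉₊).real
          {U | ∃ p ∈ plaquettesTouching (AxialGauge.boxEdges 4 (2 * ⌈β ^ θ⌉₊ + 1)),
            β ^ (2 * ε - 1) ≤ (r.N : ℝ) - plaquetteObs r.ρ p.1 p.2.1.1 p.2.1.2 U} ≤ Real.exp (-(β ^ ε)) := by
  intro G _ _ _ _ _hG
  letI : MeasurableSpace G := borel G
  haveI : BorelSpace G := ⟨rfl⟩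
  intro r θ ε hθ hε
  haveI : SecondCountableTopology (Matrix (Fin r.N) (Fin r.N) ℂ) :=
    inferInstanceAs (SecondCountableTopology (Fin r.N → Fin r.N → ℂ))
  haveI : SecondCountableTopology G :=
    (r.continuous.isClosedEmbedding r.injective).isEmbedding.secondCountableTopology
  exact boxState_largeField_rarity_of_rep r.ρ r.continuous r.mem_unitary hθ hε

end Summit.QuantumFields.YangMills.Theorems.ColdBoxAllGroups

end
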